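import Literature.Algebra.EuclideanLattices.GaussianCosetConvolution
import Literature.Algebra.EuclideanLattices.GaussianCosetSmoothing
import Literature.Probability.Distributions.StdGaussianDensity
import HarnessLib

/-!
# One-dimensional Gaussian noise from a lattice coset Gaussian: Regev 2009, Corollary 3.10 (= BLPRS 2013, Lemma 2.9)

Topic `Algebra/EuclideanLattices` (family `pqc`), sequel of `GaussianCosetConvolution.lean` (Regev 2009,
Claim 3.9 in density/event form) and `GaussianCosetSmoothing.lean` (the continuous Gaussian `D_s` as a
measure). Everything here is PROVED (theorems only, no named fact, no new definition).

It serves the decomposition of Peikert's classical `GapSVP → LWE` reduction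
(`Literature.Computability.Cryptography.peikert_gapSVPZeta_to_lwe_classical`, pqc.S20): the second
component `h₂` of `peikert_gapSVPZeta_to_lwe_classical_of_components` (`PeikertReduction.lean`) is
Peikert's Prop. 3.2 = Regev 2009, Lemma 3.4, whose analytic heart (Lemma 3.11, "main procedure of the
first part") is: the manufactured sample `(L⁻¹v mod p, ⟨x, v⟩/p + e)` is statistically close to a
genuine `LWE` sample `A_{s,Ψ_β}`. The noise part of that claim is exactly **Corollary 3.10**, proved here
from Claim 3.9; the same corollary is BLPRS 2013, Lemma 2.9 (listed as absent in the roadmap of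
`GaussianCosetSmoothing.lean`) and is used verbatim by Regev's quantum reduction (pqc.S19, Thm. 3.1 via
Lemma 3.4).

## Results

* `continuousGaussian_eq_map_smul_stdGaussian` — `D_s` (density `ρ_s/sⁿ`) is the law of `(s/√(2π))·X`,
  `X ∼ stdGaussian E` (Mathlib); hence (`continuousGaussian_map_inner`) **its one-dimensional marginals
  are Gaussian**: `⟨z, D_s⟩ = N(0, ‖z‖²s²/(2π))` (Mathlib's `IsGaussian.map_eq_gaussianReal`,
  `variance_dual_stdGaussian`).
* `continuousGaussian_real_apply`, `continuousGaussian_preimage_const_add` — `D_s(A) = ∫_A ρ_s/sⁿ`,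
  `D_s(A - c) = ∫_A ρ_s(y - c)/sⁿ dy`.
* `Regev2009.tsum_discreteGaussian_mul_continuousGaussian_real_eq_setIntegral` — **sampling semantics
  of Claim 3.9**: for `v = x + u`, `x ← D_{L,r,-u}` and `h ← D_s` independent,
  `∑_x D_{L,r,-u}(x) · D_s(A - (x + u)) = ∫_A Y` with `Y` the convolution density of
  `Regev2009.abs_setIntegral_convDensity_sub_le` (Tonelli) — the packaging of `Y` as the law of `v + h`
  that `GaussianCosetConvolution.lean` leaves to consumers.
* `Regev2009.corollary_3_10` — **Regev 2009, Cor. 3.10 = BLPRS 2013, Lemma 2.9**, event form on `ℝ`: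
  if `η_ε(L) ≤ 1/√(1/r² + (‖z‖/α)²)`, `0 < ε ≤ 1/2`, then for every measurable `B ⊆ ℝ`,
  `|∑_x D_{L,r,-u}(x) · Pr_{e ∼ N(0,α²/(2π))}[⟨z, x + u⟩ + e ∈ B] - N(0, ((r‖z‖)² + α²)/(2π))(B)| ≤ 4ε`
  (so also after any measurable post-processing, e.g. `mod 1`, by taking preimages).

## Proof of Cor. 3.10 (as printed, arXiv:2401.03703 §3.2.1)

"The distribution of `⟨z, v⟩ + e` is exactly the same as that of `⟨z, v + h⟩` where `h` is distributed
as the continuous Gaussian `ν_{α/‖z‖}`" — `continuousGaussian_map_inner` with `s = α/‖z‖`; "by Claim 3.9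
the distribution of `v + h` is within statistical distance `4ε` of `ν_{√(r² + (α/‖z‖)²)}`" — the tree's
event form of Claim 3.9 on the cylinder `⟨z, ·⟩⁻¹(B)`, its hypothesis being Cor. 3.10's
(`Regev2009.one_div_sqrt_eq_mul_div_sqrt`: `1/√(1/r² + (‖z‖/α)²) = r s/√(r² + s²)`); "taking the inner
product of this continuous Gaussian with `z` leads to a normal distribution with mean `0` and standard
deviation `√((r‖z‖)² + α²)/√(2π)`" — `continuousGaussian_map_inner` again. For `z = 0` both laws are
that of `e`.

## Conventions

`ρ_s(x) = exp(-π‖x‖²/s²)` (`gaussianFunction`), `discreteGaussian L r c` (mass `∝ ρ_r(x - c)` on `L`), the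
coset Gaussian `D_{L+u,r}` = `u + discreteGaussian L r (-u)`, `smoothingParameter L ε = η_ε(L)`,
`continuousGaussian E s = D_s` are the tree's; the normal law "with standard deviation `α/√(2π)`" of the
source is Mathlib's `gaussianReal 0 (α²/(2π))` (the variance passed through `Real.toNNReal`), the
normalisation of `LWENoise.lean` (`Ψ_α = gaussianReal 0 (α²/(2π)) mod 1`).

## References

* O. Regev, *On lattices, learning with errors, random linear codes, and cryptography*, J. ACM 56
  (2009), art. 34 = arXiv:2401.03703, Claim 3.9, Corollary 3.10 and its proof, Lemma 3.11 (§3.2.1)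
  [RegevLWE2009] (held; read `lit read arxiv:2401.03703`, chunks p0017–p0018).
* Z. Brakerski, A. Langlois, C. Peikert, O. Regev, D. Stehlé, *Classical hardness of learning with
  errors*, STOC 2013, Lemma 2.9 (arXiv:1306.0281) [BrakerskiEtAl2013].
* C. Peikert, *Public-key cryptosystems from the worst-case shortest vector problem*, STOC 2009,
  Prop. 3.2 (= Regev's Lemma 3.4) [Peikert2009].
-/

noncomputable section

open MeasureTheory ProbabilityTheory Module
open scoped Real ENNReal InnerProductSpace NNReal

namespace Literature.Algebra.EuclideanLattices

variable {E : Type*} [NormedAddCommGroup E] [InnerProductSpace ℝ E] [FiniteDimensional ℝ E]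
  [MeasurableSpace E] [BorelSpace E]

/-! ### The continuous Gaussian `D_s` is a scaled standard Gaussian -/

omit [FiniteDimensional ℝ E] [MeasurableSpace E] [BorelSpace E] in
/-- The density bookkeeping: with `c = s/√(2π)`,
`|c^d|⁻¹ · (2π)^{-d/2} · exp(-‖c⁻¹ x‖²/2) = ρ_s(x)/s^d`. [folklore] -/
theorem inv_abs_pow_mul_stdGaussian_density_eq {s : ℝ} (hs : 0 < s) (x : E) :
    |((s / Real.sqrt (2 * π)) ^ finrank ℝ E)|⁻¹ *
        ((2 * π) ^ (-(finrank ℝ E : ℝ) / 2) * Real.exp (-‖(s / Real.sqrt (2 * π))⁻¹ • x‖ ^ 2 / 2)) =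
      gaussianFunction s x / s ^ finrank ℝ E := by
  set d : ℕ := finrank ℝ E with hd
  have h2π : 0 < 2 * π := by positivity
  have hsq : 0 < Real.sqrt (2 * π) := Real.sqrt_pos.2 h2π
  set c : ℝ := s / Real.sqrt (2 * π) with hc
  have hc0 : 0 < c := div_pos hs hsq
  -- the constant
  have hconst : |(c ^ d)|⁻¹ * (2 * π) ^ (-(d : ℝ) / 2) = (s ^ d)⁻¹ := by
    rw [abs_of_pos (pow_pos hc0 d), ← Literature.Probability.Distributions.inv_sqrt_two_pi_pow d,
      NNReal.coe_one, mul_one, inv_pow, ← mul_inv, ← mul_pow, hc, div_mul_cancel₀ _ hsq.ne']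
  -- the exponent
  have hexp : -‖c⁻¹ • x‖ ^ 2 / 2 = -π * ‖x‖ ^ 2 / s ^ 2 := by
    rw [norm_smul, Real.norm_eq_abs, abs_inv, abs_of_pos hc0, mul_pow, inv_pow, hc, div_pow,
      Real.sq_sqrt h2π.le]
    field_simp
  calc |(c ^ d)|⁻¹ * ((2 * π) ^ (-(d : ℝ) / 2) * Real.exp (-‖c⁻¹ • x‖ ^ 2 / 2))
      = (|(c ^ d)|⁻¹ * (2 * π) ^ (-(d : ℝ) / 2)) * Real.exp (-‖c⁻¹ • x‖ ^ 2 / 2) := by ring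
    _ = (s ^ d)⁻¹ * gaussianFunction s x := by rw [hconst, hexp, gaussianFunction]
    _ = gaussianFunction s x / s ^ d := by rw [div_eq_inv_mul]

/-- **The continuous Gaussian is a scaled standard Gaussian**: for `0 < s`, the measure `D_s` with
density `ρ_s(x)/sⁿ` (`continuousGaussian E s`, BLPRS 2013 §2.2 / Regev's `ν_s`) is the law of
`(s/√(2π)) · X` for `X ∼ stdGaussian E` (Mathlib's standard Gaussian, identity covariance). [folklore] -/
theorem continuousGaussian_eq_map_smul_stdGaussian {s : ℝ} (hs : 0 < s) :
    continuousGaussian E s = (stdGaussian E).map (fun x => (s / Real.sqrt (2 * π)) • x) := by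
  have h2π : 0 < 2 * π := by positivity
  have hc0 : 0 < s / Real.sqrt (2 * π) := div_pos hs (Real.sqrt_pos.2 h2π)
  have he' : (fun x : E => (s / Real.sqrt (2 * π)) • x) = (MeasurableEquiv.smul₀ _ hc0.ne') := rfl
  -- transport of a density along a measurable equivalence (the tree has this as
  -- `Literature.Probability.RandomMatrix.map_withDensity_measurableEquiv`, in a file whose imports do
  -- not belong here; three lines, inlined)
  have hmap : ∀ (e : E ≃ᵐ E) (f : E → ℝ≥0∞),
      ((volume : Measure E).withDensity f).map e = ((volume : Measure E).map e).withDensity (f ∘ e.symm) := by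
    intro e f
    ext A hA
    rw [Measure.map_apply e.measurable hA, withDensity_apply _ (e.measurable hA),
      withDensity_apply _ hA, Measure.restrict_map e.measurable hA, lintegral_map_equiv]
    simp only [Function.comp_apply, e.symm_apply_apply]
  rw [Literature.Probability.Distributions.stdGaussian_eq_withDensity, he',
    hmap, ← he', Measure.map_addHaar_smul volume hc0.ne',
    withDensity_smul_measure, continuousGaussian, ← withDensity_smul _ (by fun_prop)]
  congr 1
  funext x
  simp only [Pi.smul_apply, smul_eq_mul, Function.comp_apply]
  have hsymm : (MeasurableEquiv.smul₀ _ hc0.ne').symm x = (s / Real.sqrt (2 * π))⁻¹ • x := rfl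
  rw [hsymm, ← ENNReal.ofReal_mul (by positivity), abs_inv,
    inv_abs_pow_mul_stdGaussian_density_eq hs x]

/-- **One-dimensional marginals of the continuous Gaussian**: for `0 < s` and any `z`, the law of
`⟪z, y⟫` for `y ∼ D_s` is the centred real Gaussian of variance `‖z‖² s²/(2π)` (i.e. of parameter
`s‖z‖` in the `ρ`-normalisation: "taking the inner product of this continuous Gaussian with `z` leads
to a normal distribution with mean `0` and standard deviation `‖z‖ s/√(2π)`", Regev 2009, proof of
Cor. 3.10). [cite: RegevLWE2009, Corollary 3.10 (proof)] -/
theorem continuousGaussian_map_inner {s : ℝ} (hs : 0 < s) (z : E) :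
    (continuousGaussian E s).map (fun y => ⟪z, y⟫_ℝ) =
      gaussianReal 0 (Real.toNNReal (‖z‖ ^ 2 * s ^ 2 / (2 * π))) := by
  have h2π : 0 < 2 * π := by positivity
  set c : ℝ := s / Real.sqrt (2 * π) with hc
  have hcomp : (fun y : E => ⟪z, y⟫_ℝ) ∘ (fun x : E => c • x) = (fun t : ℝ => c * t) ∘ (innerSL ℝ z) := by
    funext x
    simp only [Function.comp_apply, innerSL_apply_apply, real_inner_smul_right]
  rw [continuousGaussian_eq_map_smul_stdGaussian hs, Measure.map_map (by fun_prop) (by fun_prop),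
    hcomp, ← Measure.map_map (by fun_prop) (by fun_prop)]
  rw [IsGaussian.map_eq_gaussianReal (innerSL ℝ z), integral_strongDual_stdGaussian,
    variance_dual_stdGaussian, innerSL_apply_norm, gaussianReal_map_const_mul, mul_zero]
  congr 1
  ext
  push_cast
  rw [Real.coe_toNNReal _ (by positivity), Real.coe_toNNReal _ (by positivity), hc, div_pow,
    Real.sq_sqrt h2π.le]
  ring

/-- The probability of a measurable event under `D_s`, as a real number, is the Bochner integral of
the density: `D_s(A) = ∫_A ρ_s(y)/sⁿ dy` (`0 < s`). [cite: BrakerskiEtAl2013, §2.2] -/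
theorem continuousGaussian_real_apply {s : ℝ} (hs : 0 < s) {A : Set E} (hA : MeasurableSet A) :
    (continuousGaussian E s).real A = ∫ y in A, gaussianFunction s y / s ^ finrank ℝ E := by
  rw [measureReal_def, continuousGaussian_apply s hA]
  have hint : Integrable (fun y : E => gaussianFunction s y / s ^ finrank ℝ E) (volume.restrict A) := by
    have h := (integrable_gaussianFunction_sub hs (0 : E)).div_const (s ^ finrank ℝ E)
    exact (h.congr (Filter.Eventually.of_forall fun y => by simp [sub_zero])).restrict
  rw [← ofReal_integral_eq_lintegral_ofReal hint
    (Filter.Eventually.of_forall fun y => div_nonneg (gaussianFunction_pos s y).le (pow_nonneg hs.le _)),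
    ENNReal.toReal_ofReal (setIntegral_nonneg hA fun y _ =>
      div_nonneg (gaussianFunction_pos s y).le (pow_nonneg hs.le _))]

/-- Translation of the density: `D_s(A - c) = ∫_A ρ_s(y - c)/sⁿ dy`, i.e. the probability that
`c + h ∈ A` for `h ∼ D_s` (`ℝ≥0∞` form, valid for every `s`). [folklore] -/
theorem continuousGaussian_preimage_const_add (s : ℝ) (c : E) {A : Set E} (hA : MeasurableSet A) :
    continuousGaussian E s ((fun h => c + h) ⁻¹' A) =
      ∫⁻ y in A, ENNReal.ofReal (gaussianFunction s (y - c) / s ^ finrank ℝ E) := by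
  have hmeas : Measurable fun y : E => ENNReal.ofReal (gaussianFunction s (y - c) / s ^ finrank ℝ E) := by
    unfold gaussianFunction; fun_prop
  have hmeas0 : Measurable fun y : E => ENNReal.ofReal (gaussianFunction s y / s ^ finrank ℝ E) := by
    unfold gaussianFunction; fun_prop
  have hA' : MeasurableSet ((fun h => c + h) ⁻¹' A) := (measurable_const_add c) hA
  rw [continuousGaussian_apply s hA', ← lintegral_indicator hA', ← lintegral_indicator hA]
  have hind : (fun h : E => ((fun h => c + h) ⁻¹' A).indicator
        (fun y : E => ENNReal.ofReal (gaussianFunction s y / s ^ finrank ℝ E)) h) =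
      fun h : E => A.indicator
        (fun y : E => ENNReal.ofReal (gaussianFunction s (y - c) / s ^ finrank ℝ E)) (h + c) := by
    funext h
    by_cases hh : c + h ∈ A
    · rw [Set.indicator_of_mem (show h ∈ (fun h => c + h) ⁻¹' A from hh),
        Set.indicator_of_mem (show h + c ∈ A by rwa [add_comm]), add_sub_cancel_right]
    · rw [Set.indicator_of_notMem (show h ∉ (fun h => c + h) ⁻¹' A from hh),
        Set.indicator_of_notMem (show h + c ∉ A by rwa [add_comm])]
  rw [hind, lintegral_add_right_eq_self
    (fun y : E => A.indicator (fun y : E => ENNReal.ofReal (gaussianFunction s (y - c) / s ^ finrank ℝ E)) y) c]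

variable (L : Submodule ℤ E) [DiscreteTopology L] [IsZLattice ℝ L]

/-- **Sampling semantics of the convolution density of Claim 3.9.** For `v ← D_{L+u,r}` (i.e.
`v = x + u`, `x ← discreteGaussian L r (-u)`) and an independent `h ← D_s`, the probability that
`v + h` lies in a measurable `A` — computed as it is sampled, `∑_x D_{L,r,-u}(x) · D_s(A - (x + u))` — is
the integral over `A` of the density `Y(y) = s⁻ⁿ ∑_x D_{L,r,-u}(x) ρ_s(y - (x + u))` of
`Regev2009.abs_setIntegral_convDensity_sub_le` (Tonelli). [cite: RegevLWE2009, Claim 3.9 (the density `Y`)] -/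
theorem Regev2009.tsum_discreteGaussian_mul_continuousGaussian_real_eq_setIntegral (u : E) (r : ℝ)
    {s : ℝ} (hs : 0 < s) {A : Set E} (hA : MeasurableSet A) :
    ∑' x : L, (discreteGaussian L r (-u) x).toReal *
        (continuousGaussian E s).real ((fun h => ((x : E) + u) + h) ⁻¹' A) =
      ∫ y in A, (∑' x : L, (discreteGaussian L r (-u) x).toReal *
        gaussianFunction s (y - ((x : E) + u))) / s ^ finrank ℝ E := by
  set n : ℕ := finrank ℝ E with hn
  set D : L → ℝ≥0∞ := fun x => discreteGaussian L r (-u) x with hD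
  -- every term in `ℝ≥0∞`
  have hterm : ∀ x : L, ENNReal.ofReal ((D x).toReal *
      (continuousGaussian E s).real ((fun h => ((x : E) + u) + h) ⁻¹' A)) =
      ∫⁻ y in A, D x * ENNReal.ofReal (gaussianFunction s (y - ((x : E) + u)) / s ^ n) := by
    intro x
    haveI := isProbabilityMeasure_continuousGaussian (E := E) hs
    have hDx : D x ≠ ∞ := PMF.apply_ne_top _ _
    rw [ENNReal.ofReal_mul ENNReal.toReal_nonneg, ENNReal.ofReal_toReal hDx, measureReal_def,
      ENNReal.ofReal_toReal (measure_ne_top _ _), continuousGaussian_preimage_const_add s _ hA,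
      lintegral_const_mul _ (by unfold gaussianFunction; fun_prop)]
  have hmeas : ∀ x : L, Measurable fun y : E =>
      D x * ENNReal.ofReal (gaussianFunction s (y - ((x : E) + u)) / s ^ n) := by
    intro x; unfold gaussianFunction; fun_prop
  -- the real sum is the `toReal` of the `ℝ≥0∞` sum
  have hnonneg : ∀ x : L, 0 ≤ (D x).toReal *
      (continuousGaussian E s).real ((fun h => ((x : E) + u) + h) ⁻¹' A) :=
    fun x => mul_nonneg ENNReal.toReal_nonneg measureReal_nonneg
  have hle : ∀ x : L, (D x).toReal *
      (continuousGaussian E s).real ((fun h => ((x : E) + u) + h) ⁻¹' A) ≤ (D x).toReal := by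
    intro x
    haveI := isProbabilityMeasure_continuousGaussian (E := E) hs
    exact mul_le_of_le_one_right ENNReal.toReal_nonneg measureReal_le_one
  have hsum : Summable fun x : L => (D x).toReal *
      (continuousGaussian E s).real ((fun h => ((x : E) + u) + h) ⁻¹' A) := by
    refine Summable.of_nonneg_of_le hnonneg hle ?_
    exact ENNReal.summable_toReal (PMF.tsum_coe (discreteGaussian L r (-u)) ▸ ENNReal.one_ne_top)
  rw [← ENNReal.toReal_ofReal (tsum_nonneg hnonneg), ENNReal.ofReal_tsum_of_nonneg hnonneg hsum]
  simp_rw [hterm]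
  rw [← lintegral_tsum fun x => (hmeas x).aemeasurable]
  -- identify the integrand with `ofReal` of the real density
  have hdens : ∀ y : E, ∑' x : L, D x * ENNReal.ofReal (gaussianFunction s (y - ((x : E) + u)) / s ^ n) =
      ENNReal.ofReal ((∑' x : L, (D x).toReal * gaussianFunction s (y - ((x : E) + u))) / s ^ n) := by
    intro y
    have hnn : ∀ x : L, 0 ≤ (D x).toReal * gaussianFunction s (y - ((x : E) + u)) :=
      fun x => mul_nonneg ENNReal.toReal_nonneg (gaussianFunction_pos _ _).le
    have hsum' : Summable fun x : L => (D x).toReal * gaussianFunction s (y - ((x : E) + u)) := by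
      refine Summable.of_nonneg_of_le hnn (fun x => ?_)
        (ENNReal.summable_toReal (PMF.tsum_coe (discreteGaussian L r (-u)) ▸ ENNReal.one_ne_top))
      exact mul_le_of_le_one_right ENNReal.toReal_nonneg (gaussianFunction_le_one _ _)
    rw [← tsum_div_const, ENNReal.ofReal_tsum_of_nonneg (fun x => div_nonneg (hnn x) (pow_nonneg hs.le _))
      (hsum'.div_const _)]
    refine tsum_congr fun x => ?_
    rw [mul_div_assoc, ENNReal.ofReal_mul ENNReal.toReal_nonneg, ENNReal.ofReal_toReal (PMF.apply_ne_top _ _)]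
  simp_rw [hdens]
  -- back to the Bochner integral
  -- integrability of the density: its total `lintegral` is `∑_x D(x) · 1 = 1`
  have hY_meas : Measurable fun y : E => (∑' x : L, (D x).toReal *
      gaussianFunction s (y - ((x : E) + u))) / s ^ n :=
    Regev2009.measurable_convDensity L u r s
  have hlint : ∫⁻ y, ENNReal.ofReal ((∑' x : L, (D x).toReal *
      gaussianFunction s (y - ((x : E) + u))) / s ^ n) = 1 := by
    simp_rw [← hdens]
    rw [lintegral_tsum fun x => (hmeas x).aemeasurable]
    have hone : ∀ x : L, ∫⁻ y, D x * ENNReal.ofReal (gaussianFunction s (y - ((x : E) + u)) / s ^ n) = D x := by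
      intro x
      haveI := isProbabilityMeasure_continuousGaussian (E := E) hs
      rw [lintegral_const_mul _ (by unfold gaussianFunction; fun_prop)]
      have h1 := continuousGaussian_preimage_const_add (E := E) s ((x : E) + u) MeasurableSet.univ
      rw [Set.preimage_univ, measure_univ, Measure.restrict_univ] at h1
      rw [← h1, mul_one]
    simp_rw [hone]
    exact PMF.tsum_coe _
  have hint : Integrable (fun y : E => (∑' x : L, (D x).toReal *
      gaussianFunction s (y - ((x : E) + u))) / s ^ n) (volume.restrict A) := by
    refine Integrable.restrict (μ := volume) ⟨hY_meas.aestronglyMeasurable, ?_⟩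
    show ∫⁻ y, ‖(∑' x : L, (D x).toReal * gaussianFunction s (y - ((x : E) + u))) / s ^ n‖ₑ < ∞
    have henorm : ∀ y : E, ‖(∑' x : L, (D x).toReal * gaussianFunction s (y - ((x : E) + u))) / s ^ n‖ₑ =
        ENNReal.ofReal ((∑' x : L, (D x).toReal * gaussianFunction s (y - ((x : E) + u))) / s ^ n) :=
      fun y => Real.enorm_eq_ofReal (div_nonneg
        (tsum_nonneg fun x => mul_nonneg ENNReal.toReal_nonneg (gaussianFunction_pos _ _).le)
        (pow_nonneg hs.le _))
    simp_rw [henorm]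
    rw [hlint]
    exact ENNReal.one_lt_top
  have hnn : 0 ≤ᵐ[volume.restrict A] fun y : E => (∑' x : L, (D x).toReal *
      gaussianFunction s (y - ((x : E) + u))) / s ^ n :=
    Filter.Eventually.of_forall fun y => div_nonneg
      (tsum_nonneg fun x => mul_nonneg ENNReal.toReal_nonneg (gaussianFunction_pos _ _).le) (pow_nonneg hs.le _)
  rw [← ofReal_integral_eq_lintegral_ofReal hint hnn, ENNReal.toReal_ofReal (integral_nonneg_of_ae hnn)]

/-! ### Regev 2009, Corollary 3.10 -/

omit [InnerProductSpace ℝ E] [FiniteDimensional ℝ E] [MeasurableSpace E] [BorelSpace E] in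
/-- For `z ≠ 0` the hypothesis of Cor. 3.10 is the hypothesis of Claim 3.9 for the widths `r` and
`s = α₀/‖z‖`: `1/√(1/r² + (‖z‖/α₀)²) = r s/√(r² + s²)`. [cite: RegevLWE2009, Corollary 3.10 (proof)] -/
theorem Regev2009.one_div_sqrt_eq_mul_div_sqrt {r α₀ : ℝ} (hr : 0 < r) (hα : 0 < α₀) {z : E} (hz : z ≠ 0) :
    1 / Real.sqrt (1 / r ^ 2 + (‖z‖ / α₀) ^ 2) =
      r * (α₀ / ‖z‖) / Real.sqrt (r ^ 2 + (α₀ / ‖z‖) ^ 2) := by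
  have hz' : 0 < ‖z‖ := norm_pos_iff.2 hz
  set s : ℝ := α₀ / ‖z‖ with hsdef
  have hs : 0 < s := div_pos hα hz'
  have hzs : ‖z‖ / α₀ = s⁻¹ := by rw [hsdef, inv_div]
  have hsum : 1 / r ^ 2 + (‖z‖ / α₀) ^ 2 = (r ^ 2 + s ^ 2) / (r * s) ^ 2 := by
    rw [hzs]
    field_simp
    ring
  rw [hsum, Real.sqrt_div' _ (sq_nonneg _), Real.sqrt_sq (by positivity), one_div_div]

/-- **Regev 2009, Corollary 3.10 (= Brakerski–Langlois–Peikert–Regev–Stehlé 2013, Lemma 2.9).**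
*Let `L` be a lattice, let `z, u ∈ ℝⁿ` be vectors, and let `r, α > 0` be two reals. Assume that
`1/√(1/r² + (‖z‖/α)²) ≥ η_ε(L)` for some `ε < ½`. Then the distribution of `⟨z, v⟩ + e` where `v` is
distributed according to `D_{L+u,r}` and `e` is a normal variable with mean `0` and standard deviation
`α/√(2π)`, is within statistical distance `4ε` of a normal variable with mean `0` and standard deviation
`√((r‖z‖)² + α²)/√(2π)`.* Here `L` is a full-rank lattice of the euclidean space `E`, `0 < ε ≤ 1/2`,
the law of `v` is written `v = x + u` with `x ← discreteGaussian L r (-u)` (mass `∝ ρ_r(x + u)`),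
the normal laws are Mathlib's `gaussianReal 0 (variance)` with variances `α²/(2π)` and
`((r‖z‖)² + α²)/(2π)`, and "within statistical distance `4ε`" is spelled out on every measurable
event `B ⊆ ℝ`, the probability on the left being computed as sampled:
`|∑_x D_{L,r,-u}(x) · Pr_e[⟨z, x + u⟩ + e ∈ B] - Pr[N(0, ((r‖z‖)² + α²)/(2π)) ∈ B]| ≤ 4ε`.
Since statistical distance cannot increase under a (measurable) map, the same bound holds for the
images of both laws under any measurable `f : ℝ → Ω` (take `B = f⁻¹(C)`), in particular modulo `1`
(Regev's "in particular", `Ψ_{√((r‖z‖)² + α²)}`) or after discretisation.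
Proof as printed: `⟨z, v⟩ + e` has the law of `⟨z, v + h⟩` with `h ← D_{α/‖z‖}` (a one-dimensional
marginal of the spherical Gaussian, `continuousGaussian_map_inner`); by Claim 3.9
(`Regev2009.abs_setIntegral_convDensity_sub_le`, hypothesis rewritten by
`Regev2009.one_div_sqrt_eq_mul_div_sqrt`) `v + h` is `4ε`-close to `D_t`, `t = √(r² + α²/‖z‖²)`, on the
cylinder event `⟨z, ·⟩⁻¹(B)`, and `⟨z, D_t⟩ = N(0, ‖z‖²t²/(2π))`. (For `z = 0` both sides are the law of
`e` and the difference vanishes.) [cite: RegevLWE2009, Corollary 3.10] -/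
theorem Regev2009.corollary_3_10 (u z : E) {ε r α₀ : ℝ} (hε : 0 < ε) (hε' : ε ≤ 1 / 2)
    (hr : 0 < r) (hα : 0 < α₀)
    (hη : smoothingParameter L ε ≤ 1 / Real.sqrt (1 / r ^ 2 + (‖z‖ / α₀) ^ 2))
    {B : Set ℝ} (hB : MeasurableSet B) :
    |∑' x : L, (discreteGaussian L r (-u) x).toReal *
          (gaussianReal 0 (Real.toNNReal (α₀ ^ 2 / (2 * π)))).real
            ((fun e : ℝ => ⟪z, (x : E) + u⟫_ℝ + e) ⁻¹' B) -
        (gaussianReal 0 (Real.toNNReal ((‖z‖ ^ 2 * r ^ 2 + α₀ ^ 2) / (2 * π)))).real B| ≤ 4 * ε := by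
  have h2π : 0 < 2 * π := by positivity
  have hDsum : ∑' x : L, (discreteGaussian L r (-u) x).toReal = 1 := by
    rw [← ENNReal.tsum_toReal_eq fun x => PMF.apply_ne_top _ _, PMF.tsum_coe, ENNReal.toReal_one]
  by_cases hz : z = 0
  · -- `z = 0`: both laws are the law of `e`
    subst hz
    simp only [inner_zero_left, zero_add, Set.preimage_id', norm_zero, ne_eq, OfNat.ofNat_ne_zero,
      not_false_eq_true, zero_pow, zero_mul]
    rw [tsum_mul_right, hDsum, one_mul, sub_self, abs_zero]
    positivity
  -- `z ≠ 0`: Claim 3.9 with `s = α₀/‖z‖` on the cylinder `⟨z, ·⟩⁻¹(B)`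
  have hz' : 0 < ‖z‖ := norm_pos_iff.2 hz
  set s : ℝ := α₀ / ‖z‖ with hsdef
  have hs : 0 < s := div_pos hα hz'
  set t : ℝ := Real.sqrt (r ^ 2 + s ^ 2) with htdef
  have ht : 0 < t := Real.sqrt_pos.2 (by positivity)
  have hη' : smoothingParameter L ε ≤ r * s / Real.sqrt (r ^ 2 + s ^ 2) := by
    rwa [Regev2009.one_div_sqrt_eq_mul_div_sqrt hr hα hz] at hη
  have hmz : Measurable fun y : E => ⟪z, y⟫_ℝ := by fun_prop
  set A : Set E := (fun y : E => ⟪z, y⟫_ℝ) ⁻¹' B with hAdef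
  have hA : MeasurableSet A := hmz hB
  have h39 := Regev2009.abs_setIntegral_convDensity_sub_le L u hε hε' hr hs hη' A
  rw [← Regev2009.tsum_discreteGaussian_mul_continuousGaussian_real_eq_setIntegral L u r hs hA,
    ← continuousGaussian_real_apply ht hA] at h39
  -- the terms on the left: one-dimensional marginal of `D_s` shifted by `⟨z, x + u⟩`
  have hterm : ∀ x : L, (continuousGaussian E s).real ((fun h => ((x : E) + u) + h) ⁻¹' A) =
      (gaussianReal 0 (Real.toNNReal (α₀ ^ 2 / (2 * π)))).real
        ((fun e : ℝ => ⟪z, (x : E) + u⟫_ℝ + e) ⁻¹' B) := by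
    intro x
    have hset : (fun h => ((x : E) + u) + h) ⁻¹' A =
        (fun y : E => ⟪z, y⟫_ℝ) ⁻¹' ((fun e : ℝ => ⟪z, (x : E) + u⟫_ℝ + e) ⁻¹' B) := by
      ext h
      simp only [hAdef, Set.mem_preimage, inner_add_right]
    have hBm : MeasurableSet ((fun e : ℝ => ⟪z, (x : E) + u⟫_ℝ + e) ⁻¹' B) :=
      (measurable_const_add _) hB
    rw [hset, measureReal_def, measureReal_def, ← Measure.map_apply hmz hBm,
      continuousGaussian_map_inner hs z]
    congr 3
    rw [hsdef]
    field_simp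
  -- the right-hand side: one-dimensional marginal of `D_t`
  have htarget : (continuousGaussian E t).real A =
      (gaussianReal 0 (Real.toNNReal ((‖z‖ ^ 2 * r ^ 2 + α₀ ^ 2) / (2 * π)))).real B := by
    rw [measureReal_def, measureReal_def, hAdef, ← Measure.map_apply hmz hB,
      continuousGaussian_map_inner ht z]
    congr 3
    rw [htdef, Real.sq_sqrt (by positivity), hsdef]
    field_simp
  simp_rw [hterm] at h39
  rwa [htarget] at h39

end Literature.Algebra.EuclideanLattices
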